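import Literature.MathematicalPhysics.QuantumFieldTheory.Balaban1983to89.T4WhiteningFactor
import Literature.MathematicalPhysics.QuantumFieldTheory.Balaban1983to89.B4Sect5Torus

/-!
# T4InteractionTransport — the (W2)/(W3) binders of the Gram-whitened NE1′ tower bound from RAW
data: a discrete raw Hessian domination and a raw Lipschitz vector of the interaction, transported
through the whitening factor; and the lattice profile (W1′c) realised on the discrete torus

HEADLINE.  `[folklore]` throughout, 0 citations.  This leaf continues
`T4WhiteningFactor` (its §6 theorem
`integral_sq_sub_towerMean_le_of_graded_geometric_gramWhitenedGibbs_boxed_pathLaw`, "(M6)" in the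
record `t4/T4-EST-NE1p-P2.md`).  Three groups of binders of (M6) are posed on the WHITENED
interaction `A = P ∘ affine m S e` (`S = (BᵀB)⁻¹Bᵀ` the Gram whitening factor):

* (W2) `hδ0 hδ hα₀ hrowδ` — mixed second differences of `A` in two distinct whitened sites and
  the Dobrushin row-sum condition `∑_{j ≠ i} δ i j ≤ α₀ < 1`;
* (W3) `hω` — the one-site oscillation of `A`;
* (W1′c) `hN0 hN` together with the pseudo-distance axioms `hd_symm hd_zero hd_tri` — the
  lattice-sum profile `∑_{l'} e^{−κ d(l,l')} ≤ N` of an abstract pseudo-distance on the raw sites.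

Print never displays whitened mixed differences: the currency there is the RAW interaction (a
functional of the raw fluctuation field on a small-field box) with derivative-type bounds.  This
leaf therefore proves, as pure finite algebra,

1. §1–§2 the HYBRID (double telescoping) bound: if a raw functional `F` on a coordinate box `D`
   has its discrete mixed second differences in the raw coordinate pair `(l, l')` dominated by
   `H l l' · |a| · |b|` (`PairDomOn D F H`, a NAME FOR A HYPOTHESIS SHAPE — the discrete analogue
   of `|∂_l ∂_{l'} F| ≤ H l l'` on the box, diagonal included), then for any three raw vectors
   `u, v, w` whose four corners `u, u+v, u+w, u+v+w` lie in the box,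
   `|F(u+v+w) − F(u+v) − F(u+w) + F(u)| ≤ ∑_l ∑_{l'} H l l' · |v l| · |w l'|`;
2. §3 the TRANSPORT: the (W2) mixed difference of `F ∘ affine m S e` at whitened sites `j ≠ i`
   is such a rectangle increment with `v = S·col j · Δe_j`, `w = S·col i · Δe_i`, whence
   `≤ pairδ H S p i j := 4p² ∑_l ∑_{l'} H l l' |S l j| |S l' i|`, with Dobrushin row sums
   `∑_{j ≠ i} pairδ ≤ 4p² · s_r s_c · h` (`s_r`/`s_c` the row/column sums of `|S|`, `h` the column
   sums of `H`); and the (W3) oscillation `≤ 2p · g · s_c` from a raw Lipschitz vector `≤ g`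
   (tree `LipOn.transport` BY NAME);
3. §4 the torus realisation of (W1′c) BY NAME: raw sites injected into `Ω × Fin N₀` (sites of a
   region of the discrete torus `Π_{i<d} ℤ/P_iℤ` times `N₀` internal components), distance = the
   torus sup-distance of the underlying sites (`B4Sect5Torus.trho`), profile
   `∑_{l'} e^{−κ d(l,l')} ≤ N₀ · K_d(κ)` (`B4Sect5Torus.trho_sumBound`, `SumBound.comp`) — free
   of the period vector and of the region;
4. §5 the END-TO-END COROLLARY of (M6): (W2), (W3) and (W1′c) REPLACED by a raw interaction
   `Praw b h` on the raw box `D b h` with a raw Hessian dominator `H b h ≥ 0` of column sums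
   `≤ Hs b`, a raw Lipschitz vector `≤ g b`, the smallness conditions
   `4 p_b² · s_r s_c · Hs b ≤ α₀ < 1`, `2 p_b · g b · s_c ≤ ω`, and torus site data; everything
   else VERBATIM.  The whitened interaction is frozen to `0` beyond the horizon `n` (the tower bound
   only reads the steps `b < n`), so the raw hypotheses are asked for the performed steps `b < n`
   only (the numeric smallness conditions on the sequences `p`, `Hs`, `g` for all `b`).

ORIENTATION ONLY (neither used nor asserted by any declaration; the record carries the located
pointers): in print the small-field effective interaction is a sum of localised terms with
small coefficients, analytic on a complex neighbourhood of the small-field domain, so that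
Hessian-type dominators with summable columns and gradient-type Lipschitz vectors are the
natural data; the quadratic remainder of `T4WhiteningFactor` §8 is the instance
`H l l' = ½ (|Q l l'| + |Q l' l|)` (§2, `pairDomOn_quadForm`).

## Honest flags

* `[folklore]`: finite sums, induction on finite sets, matrix algebra over `ℝ`, and by-name
  applications of tree theorems (`T4WhiteningFactor` §5–§6, `T4GaussianWhitening` §2,
  `B4Sect5Torus` §1/§9).  0 citations; nothing printed is reproduced, quoted or claimed.
* The sizes of `H`, `Hs`, `G`, `g` for the printed effective interactions, the Gram
  identification `hrep`, coercivity `hcoer`, localisation `hMrow/hMcol` and locality `hBr/hBc`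
  remain DISPLAYED hypotheses, to be discharged (or not) from print by the record's located
  pointers; BetaPertH / (B) / (B^μ) are untouched and appear nowhere.
* Finite `T⁴` format throughout (finitely many raw and whitened sites per step, finitely many
  steps); no infinite-volume or continuum statement is made or implied.
-/

noncomputable section

open MeasureTheory ProbabilityTheory Finset Function Matrix
open scoped ENNReal

namespace Literature.MathematicalPhysics.QuantumFieldTheory.Balaban1983to89.T4InteractionTransport

open Literature.MathematicalPhysics.QuantumFieldTheory.Balaban1983to89.T4CouplingChain
open Literature.MathematicalPhysics.QuantumFieldTheory.Balaban1983to89.T4CouplingIncoherence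
open Literature.MathematicalPhysics.QuantumFieldTheory.Balaban1983to89.T4DobrushinTensorisation
open Literature.MathematicalPhysics.QuantumFieldTheory.Balaban1983to89.T4GaussianWhitening
open Literature.MathematicalPhysics.QuantumFieldTheory.Balaban1983to89.T4WhiteningFactor
open Literature.MathematicalPhysics.QuantumFieldTheory.Balaban1983to89.QGQInverse
open Literature.MathematicalPhysics.QuantumFieldTheory.Balaban1983to89.B4Sect5Torus

universe u v w

/-! ## §1 Hybrid configurations and the coordinate box -/

section Hybrid

variable {Λ : Type w} [DecidableEq Λ]

/-- `[folklore]` The hybrid configuration `u + 1_s · v + 1_t · w`: the increment `v` switched on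
exactly on the raw coordinates in `s`, the increment `w` on those in `t`. -/
def hybrid (u v w : Λ → ℝ) (s t : Finset Λ) : Λ → ℝ :=
  fun l => u l + (if l ∈ s then v l else 0) + (if l ∈ t then w l else 0)

/-- `[folklore]` Unfolding of `hybrid`. -/
theorem hybrid_apply (u v w : Λ → ℝ) (s t : Finset Λ) (l : Λ) :
    hybrid u v w s t l = u l + (if l ∈ s then v l else 0) + (if l ∈ t then w l else 0) := rfl

/-- `[folklore]` Corner `(∅, ∅)` is `u`. -/
theorem hybrid_empty_empty (u v w : Λ → ℝ) : hybrid u v w ∅ ∅ = u := by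
  funext l; simp [hybrid]

/-- `[folklore]` Corner `(univ, ∅)` is `u + v`. -/
theorem hybrid_univ_empty [Fintype Λ] (u v w : Λ → ℝ) : hybrid u v w univ ∅ = u + v := by
  funext l; simp [hybrid]

/-- `[folklore]` Corner `(∅, univ)` is `u + w`. -/
theorem hybrid_empty_univ [Fintype Λ] (u v w : Λ → ℝ) : hybrid u v w ∅ univ = u + w := by
  funext l; simp [hybrid]

/-- `[folklore]` Corner `(univ, univ)` is `u + v + w`. -/
theorem hybrid_univ_univ [Fintype Λ] (u v w : Λ → ℝ) : hybrid u v w univ univ = u + v + w := by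
  funext l; simp [hybrid]

/-- `[folklore]` Switching on one more `v`-coordinate is an additive one-site shift. -/
theorem hybrid_insert_left (u v w : Λ → ℝ) {s : Finset Λ} (t : Finset Λ) {l : Λ} (hl : l ∉ s) :
    hybrid u v w (insert l s) t = hybrid u v w s t + Pi.single l (v l) := by
  funext k
  rcases eq_or_ne k l with rfl | hk
  · simp only [hybrid, Pi.add_apply, Finset.mem_insert, true_or, if_true, if_neg hl,
      Pi.single_eq_same, add_zero]
    ring
  · simp only [hybrid, Pi.add_apply, Finset.mem_insert, hk, false_or, Pi.single_eq_of_ne hk,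
      add_zero]

/-- `[folklore]` Switching on one more `w`-coordinate is an additive one-site shift. -/
theorem hybrid_insert_right (u v w : Λ → ℝ) (s : Finset Λ) {t : Finset Λ} {l : Λ} (hl : l ∉ t) :
    hybrid u v w s (insert l t) = hybrid u v w s t + Pi.single l (w l) := by
  funext k
  rcases eq_or_ne k l with rfl | hk
  · simp only [hybrid, Pi.add_apply, Finset.mem_insert, true_or, if_true, if_neg hl,
      Pi.single_eq_same, add_zero]
  · simp only [hybrid, Pi.add_apply, Finset.mem_insert, hk, false_or, Pi.single_eq_of_ne hk,
      add_zero]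

/-- `[folklore]` If the four corners lie in the coordinate box, so does every hybrid (each
coordinate of a hybrid is the same coordinate of one of the corners). -/
theorem hybrid_mem_box {D : Λ → Set ℝ} {u v w : Λ → ℝ} (hu : ∀ k, u k ∈ D k)
    (huv : ∀ k, (u + v) k ∈ D k) (huw : ∀ k, (u + w) k ∈ D k)
    (huvw : ∀ k, (u + v + w) k ∈ D k) (s t : Finset Λ) (k : Λ) : hybrid u v w s t k ∈ D k := by
  by_cases hs : k ∈ s <;> by_cases ht : k ∈ t
  · simpa [hybrid, hs, ht] using huvw k
  · simpa [hybrid, hs, ht] using huv k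
  · simpa [hybrid, hs, ht] using huw k
  · simpa [hybrid, hs, ht] using hu k

end Hybrid

/-! ## §2 Discrete raw Hessian domination on a box and the double-telescoping bound -/

section PairDom

variable {Λ : Type w} [DecidableEq Λ]

/-- `[folklore]` `PairDomOn D F H`: on the coordinate box `{ξ | ∀ k, ξ k ∈ D k}` the discrete
mixed second difference of `F` in the raw coordinate pair `(l, l')` (diagonal `l = l'` included)
with increments `a`, `b` is at most `H l l' · |a| · |b|`, whenever the four corners lie in the box —
the discrete form of a Hessian domination `|∂_l ∂_{l'} F| ≤ H l l'` on the box.  A NAME FOR A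
HYPOTHESIS SHAPE, not an asserted fact. -/
def PairDomOn (D : Λ → Set ℝ) (F : (Λ → ℝ) → ℝ) (H : Λ → Λ → ℝ) : Prop :=
  ∀ (ξ : Λ → ℝ) (l l' : Λ) (a b : ℝ), (∀ k, ξ k ∈ D k) →
    (∀ k, (ξ + Pi.single l a : Λ → ℝ) k ∈ D k) → (∀ k, (ξ + Pi.single l' b : Λ → ℝ) k ∈ D k) →
    (∀ k, (ξ + Pi.single l a + Pi.single l' b : Λ → ℝ) k ∈ D k) →
    |F (ξ + Pi.single l a + Pi.single l' b) - F (ξ + Pi.single l a) - F (ξ + Pi.single l' b) + F ξ|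
      ≤ H l l' * (|a| * |b|)

variable {D : Λ → Set ℝ} {F : (Λ → ℝ) → ℝ} {H : Λ → Λ → ℝ}

/-- `[folklore]` A global domination is one on every box. -/
theorem PairDomOn.of_forall
    (h : ∀ (ξ : Λ → ℝ) (l l' : Λ) (a b : ℝ),
      |F (ξ + Pi.single l a + Pi.single l' b) - F (ξ + Pi.single l a) - F (ξ + Pi.single l' b) +
        F ξ| ≤ H l l' * (|a| * |b|)) :
    PairDomOn D F H :=
  fun ξ l l' a b _ _ _ _ => h ξ l l' a b

/-- `[folklore]` Restricting the box preserves the domination. -/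
theorem PairDomOn.mono {D' : Λ → Set ℝ} (hF : PairDomOn D F H) (hD : ∀ k, D' k ⊆ D k) :
    PairDomOn D' F H :=
  fun ξ l l' a b h0 h1 h2 h3 => hF ξ l l' a b (fun k => hD k (h0 k)) (fun k => hD k (h1 k))
    (fun k => hD k (h2 k)) (fun k => hD k (h3 k))

/-- `[folklore]` Enlarging the dominator preserves the domination. -/
theorem PairDomOn.of_le {H' : Λ → Λ → ℝ} (hF : PairDomOn D F H) (hH : ∀ l l', H l l' ≤ H' l l') :
    PairDomOn D F H' :=
  fun ξ l l' a b h0 h1 h2 h3 => (hF ξ l l' a b h0 h1 h2 h3).trans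
    (mul_le_mul_of_nonneg_right (hH l l') (mul_nonneg (abs_nonneg _) (abs_nonneg _)))

/-- `[folklore]` The domination is symmetric in the pair of coordinates. -/
theorem PairDomOn.symm (hF : PairDomOn D F H) : PairDomOn D F (fun l l' => H l' l) := by
  intro ξ l l' a b h0 h1 h2 h3
  show |F (ξ + Pi.single l a + Pi.single l' b) - F (ξ + Pi.single l a) - F (ξ + Pi.single l' b) +
      F ξ| ≤ H l' l * (|a| * |b|)
  have hperm : ξ + Pi.single l' b + Pi.single l a = ξ + Pi.single l a + Pi.single l' b :=
    add_right_comm ξ (Pi.single l' b) (Pi.single l a)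
  have h3' : ∀ k, (ξ + Pi.single l' b + Pi.single l a : Λ → ℝ) k ∈ D k := by
    intro k; rw [hperm]; exact h3 k
  have h := hF ξ l' l b a h0 h2 h1 h3'
  rw [hperm] at h
  have hre : F (ξ + Pi.single l a + Pi.single l' b) - F (ξ + Pi.single l a) -
      F (ξ + Pi.single l' b) + F ξ = F (ξ + Pi.single l a + Pi.single l' b) -
      F (ξ + Pi.single l' b) - F (ξ + Pi.single l a) + F ξ := by ring
  rw [hre, mul_comm |a| |b|]
  exact h

/-- `[folklore]` Dominations add. -/
theorem PairDomOn.add {F₂ : (Λ → ℝ) → ℝ} {H₂ : Λ → Λ → ℝ} (h₁ : PairDomOn D F H)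
    (h₂ : PairDomOn D F₂ H₂) : PairDomOn D (fun ξ => F ξ + F₂ ξ) (fun l l' => H l l' + H₂ l l') := by
  intro ξ l l' a b hb0 hb1 hb2 hb3
  have e₁ := h₁ ξ l l' a b hb0 hb1 hb2 hb3
  have e₂ := h₂ ξ l l' a b hb0 hb1 hb2 hb3
  calc |F (ξ + Pi.single l a + Pi.single l' b) + F₂ (ξ + Pi.single l a + Pi.single l' b) -
          (F (ξ + Pi.single l a) + F₂ (ξ + Pi.single l a)) -
          (F (ξ + Pi.single l' b) + F₂ (ξ + Pi.single l' b)) + (F ξ + F₂ ξ)|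
      = |(F (ξ + Pi.single l a + Pi.single l' b) - F (ξ + Pi.single l a) -
            F (ξ + Pi.single l' b) + F ξ) +
          (F₂ (ξ + Pi.single l a + Pi.single l' b) - F₂ (ξ + Pi.single l a) -
            F₂ (ξ + Pi.single l' b) + F₂ ξ)| := by congr 1; ring
    _ ≤ _ := abs_add_le _ _
    _ ≤ H l l' * (|a| * |b|) + H₂ l l' * (|a| * |b|) := add_le_add e₁ e₂
    _ = (H l l' + H₂ l l') * (|a| * |b|) := by ring

/-- `[folklore]` Scaling: `c · F` is dominated by `|c| · H`. -/
theorem PairDomOn.const_mul (hF : PairDomOn D F H) (c : ℝ) :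
    PairDomOn D (fun ξ => c * F ξ) (fun l l' => |c| * H l l') := by
  intro ξ l l' a b hb0 hb1 hb2 hb3
  show |c * F (ξ + Pi.single l a + Pi.single l' b) - c * F (ξ + Pi.single l a) -
      c * F (ξ + Pi.single l' b) + c * F ξ| ≤ |c| * H l l' * (|a| * |b|)
  have e := hF ξ l l' a b hb0 hb1 hb2 hb3
  have hre : c * F (ξ + Pi.single l a + Pi.single l' b) - c * F (ξ + Pi.single l a) -
      c * F (ξ + Pi.single l' b) + c * F ξ = c * (F (ξ + Pi.single l a + Pi.single l' b) -
      F (ξ + Pi.single l a) - F (ξ + Pi.single l' b) + F ξ) := by ring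
  rw [hre, abs_mul, mul_assoc]
  exact mul_le_mul_of_nonneg_left e (abs_nonneg c)

/-- `[folklore]` Affine functionals have vanishing mixed second differences. -/
theorem pairDomOn_affine (D : Λ → Set ℝ) (φ : (Λ → ℝ) →ₗ[ℝ] ℝ) (c₀ : ℝ) :
    PairDomOn D (fun ξ => c₀ + φ ξ) 0 := by
  intro ξ l l' a b _ _ _ _
  have h0 : (c₀ + φ (ξ + Pi.single l a + Pi.single l' b)) - (c₀ + φ (ξ + Pi.single l a)) -
      (c₀ + φ (ξ + Pi.single l' b)) + (c₀ + φ ξ) = 0 := by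
    simp only [map_add]; ring
  simp only [Pi.zero_apply, zero_mul, h0, abs_zero, le_refl]

/-- `[folklore]` **The quadratic instance**: `u ↦ ½ ⟨u, Q u⟩` is dominated on every box by
`H l l' = ½ (|Q l l'| + |Q l' l|)` (exact mixed second differences of a quadratic form; this is
the dominator of the quadratic remainder of `T4WhiteningFactor` §8). -/
theorem pairDomOn_quadForm [Fintype Λ] (D : Λ → Set ℝ) (Q : Matrix Λ Λ ℝ) :
    PairDomOn D (fun u => (1 / 2 : ℝ) * (u ⬝ᵥ (Q *ᵥ u)))
      (fun l l' => (1 / 2 : ℝ) * (|Q l l'| + |Q l' l|)) := by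
  intro ξ l l' a b _ _ _ _
  dsimp only
  have h1 : Pi.single l a ⬝ᵥ (Q *ᵥ Pi.single l' b) = a * (Q l l' * b) := by
    rw [single_dotProduct]
    simp only [Matrix.mulVec, dotProduct_single]
  have h2 : Pi.single l' b ⬝ᵥ (Q *ᵥ Pi.single l a) = b * (Q l' l * a) := by
    rw [single_dotProduct]
    simp only [Matrix.mulVec, dotProduct_single]
  -- the second-difference identity of a quadratic form
  have hq : (ξ + Pi.single l a + Pi.single l' b) ⬝ᵥ (Q *ᵥ (ξ + Pi.single l a + Pi.single l' b)) -
      (ξ + Pi.single l a) ⬝ᵥ (Q *ᵥ (ξ + Pi.single l a)) -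
      (ξ + Pi.single l' b) ⬝ᵥ (Q *ᵥ (ξ + Pi.single l' b)) + ξ ⬝ᵥ (Q *ᵥ ξ) =
      a * (Q l l' * b) + b * (Q l' l * a) := by
    rw [← h1, ← h2]
    simp only [Matrix.mulVec_add, add_dotProduct, dotProduct_add]
    ring
  have key : (1 / 2 : ℝ) * ((ξ + Pi.single l a + Pi.single l' b) ⬝ᵥ
        (Q *ᵥ (ξ + Pi.single l a + Pi.single l' b))) -
      (1 / 2 : ℝ) * ((ξ + Pi.single l a) ⬝ᵥ (Q *ᵥ (ξ + Pi.single l a))) -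
      (1 / 2 : ℝ) * ((ξ + Pi.single l' b) ⬝ᵥ (Q *ᵥ (ξ + Pi.single l' b))) +
      (1 / 2 : ℝ) * (ξ ⬝ᵥ (Q *ᵥ ξ)) = (1 / 2 : ℝ) * ((Q l l' + Q l' l) * (a * b)) := by
    linear_combination (1 / 2 : ℝ) * hq
  rw [key, abs_mul, abs_mul, abs_mul, abs_of_pos (by norm_num : (0 : ℝ) < 1 / 2)]
  have h3 := abs_add_le (Q l l') (Q l' l)
  have hab : 0 ≤ |a| * |b| := mul_nonneg (abs_nonneg a) (abs_nonneg b)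
  nlinarith [mul_le_mul_of_nonneg_right h3 hab]

/-- `[folklore]` COLUMN STEP of the double telescoping: switching on the `v`-coordinate `l ∉ s`
changes the `t`-increment `F(hybrid · t) − F(hybrid · ∅)` by at most
`∑_{l' ∈ t} H l l' · |v l| · |w l'|`. -/
theorem PairDomOn.abs_colIncr_le (hF : PairDomOn D F H) {u v w : Λ → ℝ} (hu : ∀ k, u k ∈ D k)
    (huv : ∀ k, (u + v) k ∈ D k) (huw : ∀ k, (u + w) k ∈ D k)
    (huvw : ∀ k, (u + v + w) k ∈ D k) {s : Finset Λ} {l : Λ} (hl : l ∉ s) (t : Finset Λ) :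
    |F (hybrid u v w (insert l s) t) - F (hybrid u v w s t) - F (hybrid u v w (insert l s) ∅) +
        F (hybrid u v w s ∅)| ≤ ∑ l' ∈ t, H l l' * (|v l| * |w l'|) := by
  induction t using Finset.induction_on with
  | empty => simp
  | @insert l' t hl' ih =>
    rw [Finset.sum_insert hl']
    have hbox := hybrid_mem_box hu huv huw huvw
    have h1 : hybrid u v w (insert l s) t = hybrid u v w s t + Pi.single l (v l) :=
      hybrid_insert_left u v w t hl
    have h2 : hybrid u v w s (insert l' t) = hybrid u v w s t + Pi.single l' (w l') :=
      hybrid_insert_right u v w s hl'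
    have h3 : hybrid u v w (insert l s) (insert l' t) =
        hybrid u v w s t + Pi.single l (v l) + Pi.single l' (w l') := by
      rw [hybrid_insert_right u v w (insert l s) hl', hybrid_insert_left u v w t hl]
    have hcell := hF (hybrid u v w s t) l l' (v l) (w l') (hbox s t)
      (fun k => by rw [← h1]; exact hbox _ _ k) (fun k => by rw [← h2]; exact hbox _ _ k)
      (fun k => by rw [← h3]; exact hbox _ _ k)
    rw [← h3, ← h1, ← h2] at hcell
    calc |F (hybrid u v w (insert l s) (insert l' t)) - F (hybrid u v w s (insert l' t)) -
            F (hybrid u v w (insert l s) ∅) + F (hybrid u v w s ∅)|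
        = |(F (hybrid u v w (insert l s) t) - F (hybrid u v w s t) -
              F (hybrid u v w (insert l s) ∅) + F (hybrid u v w s ∅)) +
            (F (hybrid u v w (insert l s) (insert l' t)) - F (hybrid u v w (insert l s) t) -
              F (hybrid u v w s (insert l' t)) + F (hybrid u v w s t))| := by
          congr 1; ring
      _ ≤ |F (hybrid u v w (insert l s) t) - F (hybrid u v w s t) -
              F (hybrid u v w (insert l s) ∅) + F (hybrid u v w s ∅)| +
            |F (hybrid u v w (insert l s) (insert l' t)) - F (hybrid u v w (insert l s) t) -
              F (hybrid u v w s (insert l' t)) + F (hybrid u v w s t)| := abs_add_le _ _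
      _ ≤ (∑ l' ∈ t, H l l' * (|v l| * |w l'|)) + H l l' * (|v l| * |w l'|) :=
          add_le_add ih hcell
      _ = H l l' * (|v l| * |w l'|) + ∑ l' ∈ t, H l l' * (|v l| * |w l'|) := add_comm _ _

/-- `[folklore]` RECTANGLE STEP: the rectangle increment over `s × t` is at most
`∑_{l ∈ s} ∑_{l' ∈ t} H l l' · |v l| · |w l'|`. -/
theorem PairDomOn.abs_rectIncr_le (hF : PairDomOn D F H) {u v w : Λ → ℝ} (hu : ∀ k, u k ∈ D k)
    (huv : ∀ k, (u + v) k ∈ D k) (huw : ∀ k, (u + w) k ∈ D k)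
    (huvw : ∀ k, (u + v + w) k ∈ D k) (s t : Finset Λ) :
    |F (hybrid u v w s t) - F (hybrid u v w s ∅) - F (hybrid u v w ∅ t) + F (hybrid u v w ∅ ∅)|
      ≤ ∑ l ∈ s, ∑ l' ∈ t, H l l' * (|v l| * |w l'|) := by
  induction s using Finset.induction_on with
  | empty => simp
  | @insert l s hl ih =>
    rw [Finset.sum_insert hl]
    have hcol := hF.abs_colIncr_le hu huv huw huvw hl t
    calc |F (hybrid u v w (insert l s) t) - F (hybrid u v w (insert l s) ∅) -
            F (hybrid u v w ∅ t) + F (hybrid u v w ∅ ∅)|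
        = |(F (hybrid u v w s t) - F (hybrid u v w s ∅) - F (hybrid u v w ∅ t) +
              F (hybrid u v w ∅ ∅)) +
            (F (hybrid u v w (insert l s) t) - F (hybrid u v w s t) -
              F (hybrid u v w (insert l s) ∅) + F (hybrid u v w s ∅))| := by
          congr 1; ring
      _ ≤ |F (hybrid u v w s t) - F (hybrid u v w s ∅) - F (hybrid u v w ∅ t) +
              F (hybrid u v w ∅ ∅)| +
            |F (hybrid u v w (insert l s) t) - F (hybrid u v w s t) -
              F (hybrid u v w (insert l s) ∅) + F (hybrid u v w s ∅)| := abs_add_le _ _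
      _ ≤ (∑ l ∈ s, ∑ l' ∈ t, H l l' * (|v l| * |w l'|)) +
            ∑ l' ∈ t, H l l' * (|v l| * |w l'|) := add_le_add ih hcol
      _ = (∑ l' ∈ t, H l l' * (|v l| * |w l'|)) +
            ∑ l ∈ s, ∑ l' ∈ t, H l l' * (|v l| * |w l'|) := add_comm _ _

/-- `[folklore]` **DOUBLE-TELESCOPING (HYBRID) BOUND.**  On the box, the full second difference
`F(u+v+w) − F(u+v) − F(u+w) + F(u)` is at most `∑_l ∑_{l'} H l l' · |v l| · |w l'|`. -/
theorem PairDomOn.abs_secondDiff_le [Fintype Λ] (hF : PairDomOn D F H) {u v w : Λ → ℝ}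
    (hu : ∀ k, u k ∈ D k) (huv : ∀ k, (u + v) k ∈ D k) (huw : ∀ k, (u + w) k ∈ D k)
    (huvw : ∀ k, (u + v + w) k ∈ D k) :
    |F (u + v + w) - F (u + v) - F (u + w) + F u| ≤ ∑ l, ∑ l', H l l' * (|v l| * |w l'|) := by
  have h := hF.abs_rectIncr_le hu huv huw huvw univ univ
  rwa [hybrid_univ_univ, hybrid_univ_empty, hybrid_empty_univ, hybrid_empty_empty] at h

end PairDom

/-! ## §3 Transport of (W2) and (W3) through the affine (whitening) reparametrisation -/

section Transport

variable {Λ : Type w} {ι : Type u} [Fintype Λ] [Fintype ι] [DecidableEq Λ] [DecidableEq ι]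
  {E : ι → Type v}

/-- `[folklore]` The raw shift produced by moving the whitened coordinate `i` from `z` to `z'`:
the `i`-th column of `S` times the reading increment. -/
def colShift (S : Matrix Λ ι ℝ) (e : (i : ι) → E i → ℝ) (i : ι) (z z' : E i) : Λ → ℝ :=
  fun l => S l i * (e i z' - e i z)

omit [Fintype Λ] [Fintype ι] [DecidableEq Λ] [DecidableEq ι] in
/-- `[folklore]` Unfolding of `colShift`. -/
theorem colShift_apply (S : Matrix Λ ι ℝ) (e : (i : ι) → E i → ℝ) (i : ι) (z z' : E i) (l : Λ) :
    colShift S e i z z' l = S l i * (e i z' - e i z) := rfl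

omit [Fintype Λ] [Fintype ι] [DecidableEq Λ] [DecidableEq ι] in
/-- `[folklore]` With readings `|e| ≤ p` the raw shift is at most `2p |S l i|` coordinatewise. -/
theorem abs_colShift_le (S : Matrix Λ ι ℝ) {e : (i : ι) → E i → ℝ} {p : ℝ}
    (hep : ∀ i x, |e i x| ≤ p) (i : ι) (z z' : E i) (l : Λ) :
    |colShift S e i z z' l| ≤ 2 * p * |S l i| := by
  rw [colShift_apply, abs_mul]
  have hΔ : |e i z' - e i z| ≤ 2 * p := by
    have := abs_sub (e i z') (e i z); have := hep i z'; have := hep i z; linarith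
  calc |S l i| * |e i z' - e i z| ≤ |S l i| * (2 * p) :=
        mul_le_mul_of_nonneg_left hΔ (abs_nonneg _)
    _ = 2 * p * |S l i| := by ring

omit [Fintype Λ] [DecidableEq Λ] in
/-- `[folklore]` Two values at the same whitened site differ, after the affine map, by the raw
shift. -/
theorem affine_update_eq_add_colShift (m : Λ → ℝ) (S : Matrix Λ ι ℝ) (e : (i : ι) → E i → ℝ)
    (η : (k : ι) → E k) (i : ι) (z z' : E i) :
    affine m S e (update η i z') = affine m S e (update η i z) + colShift S e i z z' := by
  funext l
  rw [Pi.add_apply, affine_update, affine_update, colShift_apply]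
  ring

omit [Fintype Λ] [DecidableEq Λ] in
/-- `[folklore]` Moving the whitened site `j` before a move at a DIFFERENT site `i`: the affine
image moves by the raw shift of `j`. -/
theorem affine_update_update_eq_add_colShift (m : Λ → ℝ) (S : Matrix Λ ι ℝ)
    (e : (i : ι) → E i → ℝ) {i j : ι} (hji : j ≠ i) (ξ : (k : ι) → E k) (y y' : E j) (z : E i) :
    affine m S e (update (update ξ j y') i z) =
      affine m S e (update (update ξ j y) i z) + colShift S e j y y' := by
  funext l
  rw [Pi.add_apply, colShift_apply, affine_update, affine_update, affine_update, affine_update,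
    update_of_ne hji.symm, update_of_ne hji.symm]
  ring

omit [Fintype Λ] [DecidableEq Λ] in
/-- `[folklore]` The fourth corner: both moves. -/
theorem affine_update_update_eq_add_add (m : Λ → ℝ) (S : Matrix Λ ι ℝ) (e : (i : ι) → E i → ℝ)
    {i j : ι} (hji : j ≠ i) (ξ : (k : ι) → E k) (y y' : E j) (z z' : E i) :
    affine m S e (update (update ξ j y') i z') =
      affine m S e (update (update ξ j y) i z) + colShift S e j y y' + colShift S e i z z' := by
  rw [affine_update_eq_add_colShift m S e (update ξ j y') i z z',
    affine_update_update_eq_add_colShift m S e hji ξ y y' z]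

/-- `[folklore]` The transported pair weight
`pairδ H S p i j = 4p² ∑_l ∑_{l'} H l l' · |S l j| · |S l' i|`. -/
def pairδ (H : Λ → Λ → ℝ) (S : Matrix Λ ι ℝ) (p : ℝ) (i j : ι) : ℝ :=
  4 * p ^ 2 * ∑ l, ∑ l', H l l' * (|S l j| * |S l' i|)

omit [Fintype ι] [DecidableEq Λ] [DecidableEq ι] in
/-- `[folklore]` The pair weight is nonnegative for a nonnegative dominator. -/
theorem pairδ_nonneg {H : Λ → Λ → ℝ} (hH : ∀ l l', 0 ≤ H l l') (S : Matrix Λ ι ℝ) (p : ℝ)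
    (i j : ι) : 0 ≤ pairδ H S p i j :=
  mul_nonneg (by positivity) (Finset.sum_nonneg fun l _ => Finset.sum_nonneg fun l' _ =>
    mul_nonneg (hH l l') (mul_nonneg (abs_nonneg _) (abs_nonneg _)))

/-- `[folklore]` **(W2) FROM RAW HESSIAN DOMINATION.**  If the raw functional `F` carries the
discrete Hessian dominator `H ≥ 0` on a raw box `D` containing the image of the whitened
configurations, then the whitened interaction `F ∘ affine m S e` (readings `|e| ≤ p`) has mixed
second differences at whitened sites `j ≠ i` at most `pairδ H S p i j` — the (W2) format of the
tower bound. -/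
theorem mixedDiff_comp_affine_le {D : Λ → Set ℝ} {F : (Λ → ℝ) → ℝ} {H : Λ → Λ → ℝ}
    (hF : PairDomOn D F H) (hH : ∀ l l', 0 ≤ H l l') (m : Λ → ℝ) (S : Matrix Λ ι ℝ)
    {e : (i : ι) → E i → ℝ} {p : ℝ} (hep : ∀ i x, |e i x| ≤ p)
    (hD : ∀ η l, affine m S e η l ∈ D l) :
    ∀ (i j : ι), j ≠ i → ∀ (ξ : (k : ι) → E k) (y y' : E j) (z z' : E i),
      (F (affine m S e (update (update ξ j y') i z)) - F (affine m S e (update (update ξ j y) i z))) -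
        (F (affine m S e (update (update ξ j y') i z')) -
          F (affine m S e (update (update ξ j y) i z'))) ≤ pairδ H S p i j := by
  intro i j hji ξ y y' z z'
  have h1 := affine_update_update_eq_add_colShift m S e hji ξ y y' z
  have h2 := affine_update_eq_add_colShift m S e (update ξ j y) i z z'
  have h3 := affine_update_update_eq_add_add m S e hji ξ y y' z z'
  rw [h1, h2, h3]
  set u := affine m S e (update (update ξ j y) i z) with hu
  set v := colShift S e j y y' with hv
  set w := colShift S e i z z' with hw
  have hbox := hF.abs_secondDiff_le (u := u) (v := v) (w := w) (fun k => by rw [hu]; exact hD _ k)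
    (fun k => by rw [← h1]; exact hD _ k) (fun k => by rw [← h2]; exact hD _ k)
    (fun k => by rw [← h3]; exact hD _ k)
  have hp : 0 ≤ p := (abs_nonneg _).trans (hep i z)
  have hvl : ∀ l, |v l| ≤ 2 * p * |S l j| := fun l => abs_colShift_le S hep j y y' l
  have hwl : ∀ l, |w l| ≤ 2 * p * |S l i| := fun l => abs_colShift_le S hep i z z' l
  calc F (u + v) - F u - (F (u + v + w) - F (u + w))
      ≤ |F (u + v + w) - F (u + v) - F (u + w) + F u| := by
        have := neg_abs_le (F (u + v + w) - F (u + v) - F (u + w) + F u); linarith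
    _ ≤ ∑ l, ∑ l', H l l' * (|v l| * |w l'|) := hbox
    _ ≤ ∑ l, ∑ l', H l l' * ((2 * p * |S l j|) * (2 * p * |S l' i|)) := by
        refine Finset.sum_le_sum fun l _ => Finset.sum_le_sum fun l' _ => ?_
        exact mul_le_mul_of_nonneg_left (mul_le_mul (hvl l) (hwl l') (abs_nonneg _)
          (mul_nonneg (mul_nonneg zero_le_two hp) (abs_nonneg _))) (hH l l')
    _ = pairδ H S p i j := by
        simp only [pairδ, Finset.mul_sum]
        exact Finset.sum_congr rfl fun l _ => Finset.sum_congr rfl fun l' _ => by ring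

omit [DecidableEq Λ] in
/-- `[folklore]` **Dobrushin row sums of the transported pair weights**:
`∑_{j ≠ i} pairδ H S p i j ≤ 4p² · s_r s_c · h` from the row sums `s_r` and column sums `s_c` of
`|S|` and the column sums `h` of `H` (`H ≥ 0`). -/
theorem rowSum_pairδ_le {H : Λ → Λ → ℝ} (hH : ∀ l l', 0 ≤ H l l') (S : Matrix Λ ι ℝ)
    {p sr sc hs : ℝ} (hsr : 0 ≤ sr) (hhs : 0 ≤ hs) (hrow : ∀ l, ∑ i, |S l i| ≤ sr)
    (hcol : ∀ i, ∑ l, |S l i| ≤ sc) (hHc : ∀ l', ∑ l, H l l' ≤ hs) (i : ι) :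
    ∑ j ∈ univ.erase i, pairδ H S p i j ≤ 4 * p ^ 2 * (sr * sc * hs) := by
  classical
  have h4 : 0 ≤ 4 * p ^ 2 := by positivity
  calc ∑ j ∈ univ.erase i, pairδ H S p i j
      ≤ ∑ j, pairδ H S p i j := Finset.sum_le_sum_of_subset_of_nonneg (Finset.erase_subset _ _)
          fun j _ _ => pairδ_nonneg hH S p i j
    _ = 4 * p ^ 2 * ∑ l, ∑ l', H l l' * ((∑ j, |S l j|) * |S l' i|) := by
        simp only [pairδ]
        rw [← Finset.mul_sum]
        congr 1
        rw [Finset.sum_comm]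
        refine Finset.sum_congr rfl fun l _ => ?_
        rw [Finset.sum_comm]
        refine Finset.sum_congr rfl fun l' _ => ?_
        rw [Finset.sum_mul, Finset.mul_sum]
    _ ≤ 4 * p ^ 2 * ∑ l, ∑ l', H l l' * (sr * |S l' i|) := by
        refine mul_le_mul_of_nonneg_left (Finset.sum_le_sum fun l _ =>
          Finset.sum_le_sum fun l' _ => mul_le_mul_of_nonneg_left
            (mul_le_mul_of_nonneg_right (hrow l) (abs_nonneg _)) (hH l l')) h4
    _ = 4 * p ^ 2 * (sr * ∑ l', (∑ l, H l l') * |S l' i|) := by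
        congr 1
        rw [Finset.sum_comm, Finset.mul_sum]
        refine Finset.sum_congr rfl fun l' _ => ?_
        rw [Finset.sum_mul, Finset.mul_sum]
        exact Finset.sum_congr rfl fun l _ => by ring
    _ ≤ 4 * p ^ 2 * (sr * ∑ l', hs * |S l' i|) := by
        refine mul_le_mul_of_nonneg_left (mul_le_mul_of_nonneg_left (Finset.sum_le_sum
          fun l' _ => mul_le_mul_of_nonneg_right (hHc l') (abs_nonneg _)) hsr) h4
    _ = 4 * p ^ 2 * (sr * (hs * ∑ l', |S l' i|)) := by rw [← Finset.mul_sum]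
    _ ≤ 4 * p ^ 2 * (sr * (hs * sc)) :=
        mul_le_mul_of_nonneg_left (mul_le_mul_of_nonneg_left
          (mul_le_mul_of_nonneg_left (hcol i) hhs) hsr) h4
    _ = 4 * p ^ 2 * (sr * sc * hs) := by ring

/-- `[folklore]` **(W3) FROM A RAW LIPSCHITZ VECTOR.**  If `F` carries the coordinatewise
Lipschitz vector `c ≤ g` (`0 ≤ g`) on a raw box containing the image of the whitened
configurations, then the one-site oscillation of `F ∘ affine m S e` is at most `2p · g · s_c`
(`s_c` the column sums of `|S|`) — by the tree's `LipOn.transport`. -/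
theorem osc_comp_affine_le {D : Λ → Set ℝ} {F : (Λ → ℝ) → ℝ} {c : Λ → ℝ} (hF : LipOn D F c)
    (m : Λ → ℝ) (S : Matrix Λ ι ℝ) {e : (i : ι) → E i → ℝ} {p : ℝ} (hep : ∀ i x, |e i x| ≤ p)
    (hD : ∀ η l, affine m S e η l ∈ D l) {g sc : ℝ} (hg : 0 ≤ g) (hcg : ∀ l, c l ≤ g)
    (hcol : ∀ i, ∑ l, |S l i| ≤ sc) (i : ι) (ξ : (j : ι) → E j) (y z : E i) :
    F (affine m S e (update ξ i z)) - F (affine m S e (update ξ i y)) ≤ 2 * p * (g * sc) := by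
  have h := hF.transport (m := m) (S := S) (e := e) hD (update ξ i y) i z
  rw [update_idem, update_self] at h
  have hΔ : |e i z - e i y| ≤ 2 * p := by
    have := abs_sub (e i z) (e i y); have := hep i z; have := hep i y; linarith
  have hsum : ∑ l, c l * |S l i| ≤ g * sc :=
    calc ∑ l, c l * |S l i| ≤ ∑ l, g * |S l i| :=
          Finset.sum_le_sum fun l _ => mul_le_mul_of_nonneg_right (hcg l) (abs_nonneg _)
      _ = g * ∑ l, |S l i| := (Finset.mul_sum _ _ _).symm
      _ ≤ g * sc := mul_le_mul_of_nonneg_left (hcol i) hg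
  have hsc : 0 ≤ sc := (Finset.sum_nonneg fun l _ => abs_nonneg (S l i)).trans (hcol i)
  calc F (affine m S e (update ξ i z)) - F (affine m S e (update ξ i y))
      ≤ |F (affine m S e (update ξ i y)) - F (affine m S e (update ξ i z))| := by
        rw [abs_sub_comm]; exact le_abs_self _
    _ ≤ (∑ l, c l * |S l i|) * |e i z - e i y| := h
    _ ≤ (g * sc) * (2 * p) := mul_le_mul hsum hΔ (abs_nonneg _) (mul_nonneg hg hsc)
    _ = 2 * p * (g * sc) := by ring

end Transport

/-! ## §4 The lattice profile (W1′c) realised on the discrete torus, by name -/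

section Torus

variable {d : ℕ} {P : Fin d → ℕ} {Ω : Finset (TSite d P)} {N₀ : ℕ} {Λ : Type w}

/-- `[folklore]` The pseudo-distance on raw sites injected into the torus index set
`Ω × Fin N₀` (a site of the region `Ω` of the discrete torus `Π_{i<d} ℤ/P_iℤ` and an internal
component): the torus sup-distance of the underlying sites. -/
def embDist (emb : Λ → TIdx P Ω N₀) : Λ → Λ → ℝ := fun l l' => trho P Ω N₀ (emb l) (emb l')

/-- `[folklore]` Unfolding: the torus sup-distance `tdist` of the underlying sites. -/
theorem embDist_eq (emb : Λ → TIdx P Ω N₀) (l l' : Λ) :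
    embDist emb l l' = tdist P (emb l).1.1 (emb l').1.1 := rfl

/-- `[folklore]` It is a pseudo-distance (`B4Sect5Torus.trho_isPseudoDist`, pulled back). -/
theorem isPseudoDist_embDist (hP : ∀ i, 1 ≤ P i) (emb : Λ → TIdx P Ω N₀) :
    IsPseudoDist (embDist emb) :=
  (trho_isPseudoDist hP Ω N₀).comp emb

/-- `[folklore]` **The profile, free of the period vector and of the region**: along an
injection of the raw sites, `∑_{l'} e^{−κ d(l,l')} ≤ N₀ · K_d(κ)` for every rate `κ > 0`
(`B4Sect5Torus.trho_sumBound`, `SumBound.comp`). -/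
theorem sumBound_embDist [Fintype Λ] (hP : ∀ i, 1 ≤ P i) {emb : Λ → TIdx P Ω N₀}
    (hemb : Injective emb) :
    SumBound (embDist emb) (fun a => (N₀ : ℝ) * B4Sect5Proof.latticeConst d a) :=
  (trho_sumBound hP Ω N₀).comp hemb

/-- `[folklore]` The profile inequality at one rate and one centre. -/
theorem sum_exp_embDist_le [Fintype Λ] (hP : ∀ i, 1 ≤ P i) {emb : Λ → TIdx P Ω N₀}
    (hemb : Injective emb) {κ : ℝ} (hκ : 0 < κ) (l : Λ) :
    ∑ l', Real.exp (-(κ * embDist emb l l')) ≤ (N₀ : ℝ) * B4Sect5Proof.latticeConst d κ :=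
  sumBound_embDist hP hemb κ hκ l

end Torus

/-! ## §5 The NE1′ tower bound with (W2), (W3) from raw data and (W1′c) on the torus -/

section EndToEnd

open Preorder MeasureTheory.Filtration

variable {X : ℕ → Type*} [∀ n, MeasurableSpace (X n)]

open scoped Classical in
/-- `[folklore]` **NE1′ TOWER BOUND, GRAM-WHITENED GIBBS FORM, (W2)/(W3) FROM RAW DATA, (W1′c)
ON THE TORUS.**  This is
`T4WhiteningFactor.integral_sq_sub_towerMean_le_of_graded_geometric_gramWhitenedGibbs_boxed_pathLaw`
with

* the whitened interaction SPECIALISED to `P_{b,h} ∘ affine (m b h) S_{b,h} (e b)` for a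
  displayed RAW interaction `Praw b h` on the raw box `D b h` (measurable, `|Praw| ≤ a b h` on the
  box; hypotheses for the performed steps `b < n` only), frozen to `0` at the steps `b ≥ n` which
  the bound never reads;
* (W2) REPLACED by a raw discrete Hessian dominator `H b h ≥ 0` of `Praw b h` on `D b h`
  (`PairDomOn`) with column sums `≤ Hs b` and the smallness
  `4 p_b² · ((γ−ρ)⁻¹Nβ_c) · ((γ−ρ)⁻¹Nβ_r) · Hs b ≤ α₀ < 1`;
* (W3) REPLACED by a raw Lipschitz vector `G b h ≤ g b` (`0 ≤ g b`) of `Praw b h` on `D b h` with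
  `2 p_b · g b · ((γ−ρ)⁻¹Nβ_r) ≤ ω` (`0 ≤ ω`);
* (W1′c) and the pseudo-distance REPLACED by torus site data: period vectors `Pv b` (all periods
  `≥ 1`), regions `Ω b`, `N₀` internal components, injections `emb b` of the raw sites, and any
  `N ≥ N₀ · K_d(κ)` (`κ > 0`); the localisation hypotheses are stated in the induced torus
  distance `embDist (emb b)`.

Every other binder — path law, kernels, Gram representation `hrep` (now displaying the raw
interaction), coercivity, localisation, locality of `B`, raw ES sensitivities, domination,
graded-geometric profile — is passed VERBATIM, and the conclusion is that of the parent. -/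
theorem integral_sq_sub_towerMean_le_of_graded_geometric_rawInteraction_torus_pathLaw
    (μ : Measure (Π n, X n)) [IsFiniteMeasure μ]
    (κ' : (b : ℕ) → Kernel (Π i : Iic b, X i) (X (b + 1))) [∀ b, IsMarkovKernel (κ' b)]
    (hκ' : ∀ b, μ.map (frestrictLe b) ⊗ₘ κ' b = μ.map (fun x => (frestrictLe b x, x (b + 1))))
    (n : ℕ) {φ : (Π k, X k) → ℝ} (hφn : StronglyMeasurable[piLE (X := X) n] φ) {R : ℝ}
    (hφR : ∀ x, |φ x| ≤ R)
    {Λ : ℕ → Type w} [∀ b, Fintype (Λ b)] [∀ b, DecidableEq (Λ b)]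
    {ι : ℕ → Type u} [∀ b, Fintype (ι b)] [∀ b, DecidableEq (ι b)] {E : (b : ℕ) → ι b → Type v}
    [∀ b i, MeasurableSpace (E b i)]
    {T : (b : ℕ) → (Π i : Iic b, X i) → (Λ b → ℝ) → X (b + 1)} (hT : ∀ b h, Measurable (T b h))
    (m : (b : ℕ) → (Π i : Iic b, X i) → Λ b → ℝ)
    (Bm : (b : ℕ) → (Π i : Iic b, X i) → Matrix (ι b) (Λ b) ℝ)
    {e : (b : ℕ) → (i : ι b) → E b i → ℝ} (he : ∀ b i, Measurable (e b i))
    {p : ℕ → ℝ} (hep : ∀ b i x, |e b i x| ≤ p b)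
    (π : (b : ℕ) → (Π i : Iic b, X i) → (i : ι b) → Measure (E b i))
    [∀ b h i, IsProbabilityMeasure (π b h i)] {v : ℝ} (hv0 : 0 ≤ v)
    (hv : ∀ b h i, ∫ y, e b i y ^ 2 ∂(π b h i) ≤ v)
    -- the RAW interaction on a raw box containing the image of the whitened configurations
    {D : (b : ℕ) → (Π i : Iic b, X i) → Λ b → Set ℝ}
    (hD : ∀ b < n, ∀ h η l, affine (m b h) (whiteningFactor (Bm b h)) (e b) η l ∈ D b h l)
    (Praw : (b : ℕ) → (Π i : Iic b, X i) → (Λ b → ℝ) → ℝ)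
    (hPm : ∀ b < n, ∀ h, Measurable (Praw b h))
    {a : (b : ℕ) → (Π i : Iic b, X i) → ℝ}
    (hPb : ∀ b < n, ∀ h ξ, (∀ l, ξ l ∈ D b h l) → |Praw b h ξ| ≤ a b h)
    (hrep : ∀ b < n, ∀ h, κ' b h =
      (gibbsMeasure (π b h)
          (fun η => Praw b h (affine (m b h) (whiteningFactor (Bm b h)) (e b) η))).map
        (fun η => T b h (affine (m b h) (whiteningFactor (Bm b h)) (e b) η)))
    -- (W2) from a raw discrete Hessian dominator with summable columns
    (H : (b : ℕ) → (Π i : Iic b, X i) → Λ b → Λ b → ℝ)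
    (hH0 : ∀ b < n, ∀ h l l', 0 ≤ H b h l l')
    (hHdom : ∀ b < n, ∀ h, PairDomOn (D b h) (Praw b h) (H b h))
    {Hs : ℕ → ℝ} (hHs0 : ∀ b, 0 ≤ Hs b) (hHs : ∀ b < n, ∀ h l', ∑ l, H b h l l' ≤ Hs b)
    -- (W3) from a raw Lipschitz vector
    {G : (b : ℕ) → (Π i : Iic b, X i) → Λ b → ℝ}
    (hG : ∀ b < n, ∀ h, LipOn (D b h) (Praw b h) (G b h))
    {g : ℕ → ℝ} (hg : ∀ b, 0 ≤ g b) (hGg : ∀ b < n, ∀ h l, G b h l ≤ g b)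
    -- raw ES sensitivities, verbatim
    {c : (b : ℕ) → (Π i : Iic b, X i) → Λ b → ℝ}
    (hc : ∀ b < n, ∀ h, LipOn (D b h) (fun ξ => fiberMean κ' (b + 1) φ (succGlue b (h, T b h ξ)))
      (c b h))
    -- (W1′) on the torus: site data, coercivity, localisation in the torus distance, locality
    {d : ℕ} {Pv : ℕ → Fin d → ℕ} (hPv : ∀ b i, 1 ≤ Pv b i)
    (Ω : (b : ℕ) → Finset (TSite d (Pv b))) (N₀ : ℕ)
    (emb : (b : ℕ) → Λ b → TIdx (Pv b) (Ω b) N₀) (hemb : ∀ b, Injective (emb b))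
    {γ κ ρ N βr βc : ℝ} (hργ : ρ < γ) (hκ : 0 < κ)
    (hcoer : ∀ b < n, ∀ h, Coercive ((Bm b h)ᵀ * Bm b h) γ)
    (hMrow : ∀ b < n, ∀ h (i : Λ b),
      ∑ j, |((Bm b h)ᵀ * Bm b h) i j| * (Real.exp (κ * embDist (emb b) i j) - 1) ≤ ρ)
    (hMcol : ∀ b < n, ∀ h (j : Λ b),
      ∑ i, |((Bm b h)ᵀ * Bm b h) i j| * (Real.exp (κ * embDist (emb b) i j) - 1) ≤ ρ)
    (hNK : (N₀ : ℝ) * B4Sect5Proof.latticeConst d κ ≤ N)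
    (hβr : 0 ≤ βr) (hBr : ∀ b < n, ∀ h (i : ι b), ∑ l, |Bm b h i l| ≤ βr)
    (hβc : 0 ≤ βc) (hBc : ∀ b < n, ∀ h (l : Λ b), ∑ i, |Bm b h i l| ≤ βc)
    -- smallness of the transported constants
    {α₀ : ℝ} (hα₀ : α₀ < 1)
    (hα : ∀ b, 4 * p b ^ 2 * (((γ - ρ)⁻¹ * N * βc) * ((γ - ρ)⁻¹ * N * βr) * Hs b) ≤ α₀)
    {ω : ℝ} (hω0 : 0 ≤ ω) (hωb : ∀ b, 2 * p b * (g b * ((γ - ρ)⁻¹ * N * βr)) ≤ ω)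
    -- measurability / boundedness side conditions and the graded-geometric profile, verbatim
    (hWm : ∀ b, StronglyMeasurable (fun h => ∑ l, c b h l ^ 2)) {CW : ℝ}
    (hWb : ∀ b h, |∑ l, c b h l ^ 2| ≤ CW)
    (Mf : (b : ℕ) → Finset (Λ b)) {C κ₁ Etot : ℝ} (hκ₁ : 1 ≤ κ₁) {Θ : ℕ → ℝ}
    {J : ℕ → Type*} (Jset : (b : ℕ) → Λ b → Finset (J b))
    {Aev : (b : ℕ) → Λ b → J b → Set (Π i : Iic b, X i)}
    (hA : ∀ b < n, ∀ l ∈ Mf b, ∀ j ∈ Jset b l, MeasurableSet (Aev b l j))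
    (hc0 : ∀ b < n, ∀ h, ∀ l ∉ Mf b, c b h l = 0)
    (hcg : ∀ b < n, ∀ h, ∀ l ∈ Mf b,
      |c b h l| ≤ C * Θ b * κ₁ ^ ((Jset b l).filter fun j => h ∈ Aev b l j).card)
    {ε : (b : ℕ) → Λ b → J b → ℝ} (hε : ∀ b < n, ∀ l ∈ Mf b, ∀ j ∈ Jset b l, 0 ≤ ε b l j)
    (hE : ∀ b < n, ∀ l ∈ Mf b, ∑ j ∈ Jset b l, ε b l j ≤ Etot)
    (hdomA : ∀ b < n, ∀ l ∈ Mf b, ∀ S' ⊆ Jset b l,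
      μ.real (⋂ j ∈ S', {x | frestrictLe b x ∈ Aev b l j}) ≤ μ.real Set.univ * ∏ j ∈ S', ε b l j)
    {P r : ℝ} (hP : 0 ≤ P) (hr0 : 0 ≤ r) (hr1 : r < 1)
    (hgeo : ∀ b, ((Mf b).card : ℝ) * (Θ b ^ 2 * (Real.exp ω * (2 * v + 2 * p b ^ 2))) ≤ P * r ^ b) :
    ∫ x, (φ x - towerMean κ' φ (x 0)) ^ 2 ∂μ ≤
      (1 / (1 - α₀)) * ((1 / 2 : ℝ) * (C ^ 2 * (((γ - ρ)⁻¹ * N * βc) * ((γ - ρ)⁻¹ * N * βr))) *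
        (μ.real Set.univ * Real.exp ((κ₁ ^ 2 - 1) * Etot)) * (P / (1 - r))) := by
  -- the constants of the whitening factor, for the steps the bound reads
  have hN0 : 0 ≤ N := (profile_nonneg d N₀ κ hκ).trans hNK
  have hK : 0 ≤ (γ - ρ)⁻¹ * N := mul_nonneg (inv_nonneg.mpr (by linarith)) hN0
  have hdist : ∀ b, IsPseudoDist (embDist (emb b)) :=
    fun b => isPseudoDist_embDist (hPv b) (emb b)
  have hprof : ∀ b (l : Λ b), ∑ l', Real.exp (-(κ * embDist (emb b) l l')) ≤ N :=
    fun b l => (sum_exp_embDist_le (hPv b) (hemb b) hκ l).trans hNK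
  have hsums : ∀ b < n, ∀ h,
      (∀ l, ∑ i, |whiteningFactor (Bm b h) l i| ≤ (γ - ρ)⁻¹ * N * βc) ∧
        (∀ i, ∑ l, |whiteningFactor (Bm b h) l i| ≤ (γ - ρ)⁻¹ * N * βr) :=
    fun b hb h => whiteningFactor_sums_le (Bm b h) (embDist (emb b)) hργ hκ.le (hcoer b hb h)
      (hdist b).symm (hdist b).zero (hdist b).triangle (hMrow b hb h) (hMcol b hb h) hN0
      (hprof b) (hBr b hb h) hβc (hBc b hb h)
  -- the frozen whitened interaction and its transported pair weights
  let A : (b : ℕ) → (Π i : Iic b, X i) → ((i : ι b) → E b i) → ℝ := fun b h η =>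
    if b < n then Praw b h (affine (m b h) (whiteningFactor (Bm b h)) (e b) η) else 0
  let δ : (b : ℕ) → (Π i : Iic b, X i) → ι b → ι b → ℝ := fun b h i j =>
    if b < n then pairδ (H b h) (whiteningFactor (Bm b h)) (p b) i j else 0
  have hA_of_lt : ∀ b, b < n → ∀ h, A b h =
      fun η => Praw b h (affine (m b h) (whiteningFactor (Bm b h)) (e b) η) := by
    intro b hb h; funext η; simp only [A, if_pos hb]
  have hA_of_le : ∀ b, ¬ b < n → ∀ h, A b h = fun _ => 0 := by
    intro b hb h; funext η; simp only [A, if_neg hb]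
  have hAm : ∀ b h, Measurable (A b h) := by
    intro b h
    by_cases hb : b < n
    · rw [hA_of_lt b hb h]; exact (hPm b hb h).comp (measurable_affine _ _ (he b))
    · rw [hA_of_le b hb h]; exact measurable_const
  have hAb : ∀ b h η, |A b h η| ≤ (fun b h => if b < n then a b h else 0) b h := by
    intro b h η
    by_cases hb : b < n
    · simp only [hA_of_lt b hb h, if_pos hb]
      exact hPb b hb h _ fun l => hD b hb h η l
    · simp only [hA_of_le b hb h, if_neg hb, abs_zero, le_refl]
  have hrep' : ∀ b < n, ∀ h, κ' b h = (gibbsMeasure (π b h) (A b h)).map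
      (fun η => T b h (affine (m b h) (whiteningFactor (Bm b h)) (e b) η)) := by
    intro b hb h; rw [hA_of_lt b hb h]; exact hrep b hb h
  have hδ0 : ∀ b h i j, 0 ≤ δ b h i j := by
    intro b h i j
    by_cases hb : b < n
    · simp only [δ, if_pos hb]; exact pairδ_nonneg (hH0 b hb h) _ _ i j
    · simp only [δ, if_neg hb, le_refl]
  have hδ : ∀ b h (i j : ι b), j ≠ i → ∀ (ξ : (k : ι b) → E b k) (y y' : E b j) (z z' : E b i),
      (A b h (update (update ξ j y') i z) - A b h (update (update ξ j y) i z)) -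
        (A b h (update (update ξ j y') i z') - A b h (update (update ξ j y) i z')) ≤ δ b h i j := by
    intro b h i j hji ξ y y' z z'
    by_cases hb : b < n
    · simp only [hA_of_lt b hb h, δ, if_pos hb]
      exact mixedDiff_comp_affine_le (hHdom b hb h) (hH0 b hb h) (m b h) (whiteningFactor (Bm b h))
        (hep b) (hD b hb h) i j hji ξ y y' z z'
    · simp only [hA_of_le b hb h, δ, if_neg hb, sub_self, le_refl]
  have hα0 : 0 ≤ α₀ := by
    have h0 := hα 0
    have : 0 ≤ 4 * p 0 ^ 2 * (((γ - ρ)⁻¹ * N * βc) * ((γ - ρ)⁻¹ * N * βr) * Hs 0) :=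
      mul_nonneg (by positivity) (mul_nonneg (mul_nonneg (mul_nonneg hK hβc) (mul_nonneg hK hβr))
        (hHs0 0))
    linarith
  have hrowδ : ∀ b h (i : ι b), ∑ j ∈ univ.erase i, δ b h i j ≤ α₀ := by
    intro b h i
    by_cases hb : b < n
    · simp only [δ, if_pos hb]
      exact (rowSum_pairδ_le (p := p b) (hH0 b hb h) (whiteningFactor (Bm b h)) (mul_nonneg hK hβc)
        (hHs0 b) (hsums b hb h).1 (hsums b hb h).2 (hHs b hb h) i).trans (hα b)
    · simp only [δ, if_neg hb, Finset.sum_const_zero]; exact hα0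
  have hω : ∀ b h (i : ι b) (ξ : (j : ι b) → E b j) (y z : E b i),
      A b h (update ξ i z) - A b h (update ξ i y) ≤ ω := by
    intro b h i ξ y z
    by_cases hb : b < n
    · simp only [hA_of_lt b hb h]
      exact (osc_comp_affine_le (hG b hb h) (m b h) (whiteningFactor (Bm b h)) (hep b) (hD b hb h)
        (hg b) (hGg b hb h) (hsums b hb h).2 i ξ y z).trans (hωb b)
    · simp only [hA_of_le b hb h, sub_self]; exact hω0
  exact integral_sq_sub_towerMean_le_of_graded_geometric_gramWhitenedGibbs_boxed_pathLaw μ κ'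
    hκ' n hφn hφR hT m Bm he hep π hv0 hv A hAm hAb hrep' hδ0 hδ hα₀ hrowδ hω hD hc
    (fun b => embDist (emb b)) (fun b => (hdist b).symm)
    (fun b => (hdist b).zero) (fun b => (hdist b).triangle) hργ hκ.le hcoer hMrow hMcol hN0
    (fun b _ l => hprof b l) hβr hBr hβc hBc hWm hWb Mf hκ₁ Jset hA hc0 hcg hε hE hdomA hP hr0
    hr1 hgeo

end EndToEnd

end Literature.MathematicalPhysics.QuantumFieldTheory.Balaban1983to89.T4InteractionTransport
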